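import Mathlib
import Summits.NavierStokesRegularity.NavierStokesRegularity.Theorems.TaoLadderRungTwoFlatTruncatedHopTwoGauge
import Summits.NavierStokesRegularity.NavierStokesRegularity.Theorems.TaoLadderRungTwoFlatRenormFrameOn
import HarnessLib

/-!
# The contraction gauge in the renormalised frame (companion of `…TaoLadderRungTwoFlatGradedDeviation`)
  (helper for the K_A♭ parent item stmt-NavierStokesRegularity-22987, child 2A `GradedAdiabaticWakeA` of route
  TaoLadderRungTwoFlat; cell harvest/h2-tao-ladder, p1 g22)

`MirrorPulse.gauge_deviation_of_gradedFlows` reads a gauge `ω` on the graded amplitudes as `ω/c` on the renormalised ones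
(`c_k = (1+ε₀)^{5k/2}`) and asks for window-regularity of `ω/c`. For the frame's contraction gauge `ω = geomGauge g b` this
holds with constant `max(g,b)·(1+ε₀)^{5/2}`:

* `clockW_le_of_le_succ` — `c_k ≤ (1+ε₀)^{5/2} c_n` for `k ≤ n+1` (`ε₀ ≥ 0`);
* `isWindowRegular_geomGauge_div_clockW` — `IsWindowRegular (geomGauge g b / c) (max g b · (1+ε₀)^{5/2})`.

HONEST FRAMING: gauge bookkeeping for a MODEL lattice; nothing certified; nothing about the Navier–Stokes equations.
-/

noncomputable section

-- the sub-problem namespace repeats the summit name by design (D-0017)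
set_option linter.dupNamespace false

namespace Summit.NavierStokesRegularity.NavierStokesRegularity.Theorems

open Set Filter Literature.Analysis.FluidPDE Literature.Analysis.FluidPDE.TaoCascade QuadPolar RenormFrame

namespace MirrorPulse

/-- Neighbouring clocks differ by at most `(1+ε₀)^{5/2}`: `c_k ≤ (1+ε₀)^{5/2}·c_n` for `k ≤ n + 1`, `ε₀ ≥ 0`.
[cite: Tao2016AveragedNS, §4 (4.8); route TaoLadderRungTwoFlat, renormalised gauge bookkeeping] -/
theorem clockW_le_of_le_succ {ε₀ : ℝ} (hε₀ : 0 ≤ ε₀) {k n : ℤ} (hkn : k ≤ n + 1) :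
    clockW ε₀ k ≤ (1 + ε₀) ^ ((5 : ℝ) / 2) * clockW ε₀ n := by
  unfold clockW
  have hL : (0 : ℝ) < 1 + ε₀ := by linarith
  rw [← Real.rpow_add hL]
  apply Real.rpow_le_rpow_of_exponent_le (by linarith)
  have : (k : ℝ) ≤ n + 1 := by exact_mod_cast hkn
  linarith

/-- **The contraction gauge read in the renormalised frame is window-regular**: `ω/c` with `ω = geomGauge g b`
(`g, b ≥ 1`) and `c_k = (1+ε₀)^{5k/2}` (`ε₀ ≥ 0`) satisfies `IsWindowRegular (ω/c) (max g b · (1+ε₀)^{5/2})` — the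
hypothesis `hωreg` of `gauge_deviation_of_gradedFlows`. [folklore; route TaoLadderRungTwoFlat, renormalised gauge bookkeeping] -/
theorem isWindowRegular_geomGauge_div_clockW {g b ε₀ : ℝ} (hg : 1 ≤ g) (hb : 1 ≤ b) (hε₀ : 0 ≤ ε₀) :
    IsWindowRegular (fun i k => geomGauge g b i k / clockW ε₀ k) (max g b * (1 + ε₀) ^ ((5 : ℝ) / 2)) := by
  obtain ⟨hpos, hΛ, hreg⟩ := isWindowRegular_geomGauge hg hb
  have hε' : (-1 : ℝ) < ε₀ := by linarith
  have hc : ∀ k, 0 < clockW ε₀ k := clockW_pos hε'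
  have hP : (1 : ℝ) ≤ (1 + ε₀) ^ ((5 : ℝ) / 2) := Real.one_le_rpow (by linarith) (by norm_num)
  refine ⟨fun i k => div_pos (hpos i k) (hc k), ?_, ?_⟩
  · calc (1 : ℝ) = 1 * 1 := by ring
      _ ≤ max g b * (1 + ε₀) ^ ((5 : ℝ) / 2) := mul_le_mul hΛ hP zero_le_one (by linarith)
  · intro i j n k hk
    have h1 := hreg i j n k hk
    have h2 : clockW ε₀ k ≤ (1 + ε₀) ^ ((5 : ℝ) / 2) * clockW ε₀ n := clockW_le_of_le_succ hε₀ hk.2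
    have hcn := hc n
    have hck := hc k
    have hωk := (hpos j k).le
    -- ω_n / c_n ≤ (Λ ω_k)/c_n ≤ Λ ω_k · (1+ε₀)^{5/2} / c_k
    rw [div_le_iff₀ hcn]
    calc geomGauge g b i n ≤ max g b * geomGauge g b j k := h1
      _ = max g b * (geomGauge g b j k / clockW ε₀ k) * clockW ε₀ k := by field_simp
      _ ≤ max g b * (geomGauge g b j k / clockW ε₀ k) * ((1 + ε₀) ^ ((5 : ℝ) / 2) * clockW ε₀ n) :=
          mul_le_mul_of_nonneg_left h2 (mul_nonneg (by linarith) (div_nonneg hωk hck.le))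
      _ = max g b * (1 + ε₀) ^ ((5 : ℝ) / 2) * (geomGauge g b j k / clockW ε₀ k) * clockW ε₀ n := by ring

end MirrorPulse

end Summit.NavierStokesRegularity.NavierStokesRegularity.Theorems

end
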